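import Literature.Analysis.FluidPDE.PeriodicBoundedMildLocal
import Literature.Analysis.FluidPDE.PeriodicBoundedMildMean
import Literature.Analysis.FluidPDE.ClassicalSolutionTorusProofs
import Literature.Analysis.FluidPDE.TorusHeatForcedIcc
import Literature.Analysis.FunctionSpaces.TorusClassicalNSGluing
import HarnessLib

/-!
# Local classical solutions of Navier–Stokes on `𝕋³` from bounded smooth data

Analysis/FluidPDE proofs file (everything proved; no definitions, no named facts) on the
discharge path of `Literature.Barriers.NavierStokesRegularity.CoiculescuPalasek2025_globalExtension`
(`Barriers/NavierStokesRegularity/CriticalDataSmoothNonuniquenessProofs.lean`; Coiculescu–Palasek,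
Invent. Math. 244 (2025), §5, last paragraph: a smooth solution on `𝕋³` with small data at time
`T` is continued globally by the classical small-data theory). This file supplies the **local
existence theorem on the torus with an existence time depending only on the sup norm of the
datum** (`Torus.exists_classicalNS_of_bounded_data`): there are `ε₀ > 0`, `C₀ ≥ 1`, `K ≥ 0`
such that every smooth divergence-free `a : 𝕋³ → ℝ³` with `‖a‖_∞ ≤ M` is the initial value, at
any initial time `s`, of a classical solution `(V, Q)` of the unforced Navier–Stokes equations
(`ν = 1`) on `(s, s + ε₀/M²) × 𝕋³` with `‖V‖ ≤ C₀M`,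
`‖V(t) − e^{(t−s)Δ}a‖_∞ ≤ K √(t−s) (C₀M)²` (so `V(t) → a` uniformly) and `∫ V(t) = ∫ a`.

The solution is the whole-space bounded mild solution from the periodic lift `ã`
(`exists_classical_of_bounded_data`, `PeriodicBoundedMildLocal.lean`: Koch–Nadirashvili–
Seregin–Šverák 2009, §4; Giga–Inui–Matsui 1999), which is `ℤ³`-periodic in space, read on the
torus. The one non-formal point is the **periodicity of the pressure**: the whole-space pressure
gradient `∇p = Δv − ∂ₜv − (v·∇)v` is periodic, so `p(t, · + eⱼ) − p(t, ·) = cⱼ(t)` is constant in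
space and `θ = p − ⟨c(t), ·⟩` is periodic; `(v, θ)` then solves the system with the spatially
constant force `−c(t)`, descends to the torus (`IsClassicalNSSolutionOn.to_torus_holds`), where
the mean velocity evolves by the mean force (`Torus.IsClassicalNSSolutionOn.hasDerivWithinAt_integral_velocity`);
but the mild formula preserves the mean (`Torus.integral_heatExtension_lift_repr`,
`Torus.integral_oseenDuhamel_repr_eq_zero`, `PeriodicBoundedMildMean.lean`), so `c ≡ 0`: the
pressure of a bounded mild solution has no linear part (KNSS 2009, §3 p. 6 and Lemma 3.1: the
drift ambiguity `b(t)` of `L^∞` solutions is absent for mild solutions).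

* `IsClassicalNSSolutionOn.congr_pressure`, `Torus.IsClassicalNSSolutionOn.comp_add_const` —
  bookkeeping (modification of the pressure off the time set; time translation on the torus);
* `Torus.exists_classicalNS_of_bounded_data` — the theorem above.

## Mathlib / tree search

Tree: `exists_classical_of_bounded_data`, `IsClassicalNSSolutionOn.congr_velocity`,
`IsClassicalNSSolutionOn.to_torus_holds`, `isDivFree_lift_iff`,
`VectorCalculus.IsDivFree.isWeaklyDivFree_holds`, `Torus.lift_descend_holds`,
`Torus.latticeVec_single`, `Torus.proj_latticeVec`, `laplacian_comp_add_right`,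
`Torus.IsSmoothSpaceTimeOn.comp_add_const`, `Torus.timeDerivWithin_comp_add_const`,
`Torus.IsClassicalNSSolutionOn.hasDerivWithinAt_integral_velocity`,
`exists_norm_oseenDuhamel_bounded_le`. Mathlib: `fderiv_comp_add_right`,
`is_const_of_fderiv_eq_zero`, `Orthonormal.inner_left_fintype`, `UniqueDiffWithinAt.eq_deriv`.

## References

* G. Koch, N. Nadirashvili, G. Seregin, V. Šverák, Acta Math. 203 (2009) = arXiv:0709.3599,
  §3 (p. 6, Lemma 3.1, Remark 3.1) and §4 p. 8. [KochNadirashviliSereginSverak2009]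
* Y. Giga, K. Inui, S. Matsui, Quaderni di Matematica 4 (1999) 27–68, Thm. 1.
* J. C. Robinson, J. L. Rodrigo, W. Sadowski, *The Three-Dimensional Navier–Stokes Equations*,
  CUP 2016, §6.3, Thm. 6.8 / §7.2 (local strong/classical solutions on the torus).
  [RobinsonRodrigoSadowskiCUP2016]
* M. P. Coiculescu, S. Palasek, Invent. Math. 244 (2025) = arXiv:2503.14699, §5.
  [CoiculescuPalasek2025]
-/

noncomputable section

open MeasureTheory Set Function Filter TopologicalSpace InnerProductSpace Metric
open Literature.Analysis.FunctionSpaces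
open _root_.Topology
open scoped RealInnerProductSpace Laplacian ContDiff NNReal ENNReal

namespace Literature.Analysis.FluidPDE

/-! ### Bookkeeping -/

section Congr

variable {E : Type*} [NormedAddCommGroup E] [InnerProductSpace ℝ E] [FiniteDimensional ℝ E]

/-- A classical solution stays classical when the pressure is modified at times outside the time
set `S` (the clauses only see the slices `p t`, `t ∈ S`). [folklore] -/
theorem IsClassicalNSSolutionOn.congr_pressure {S : Set ℝ} {ν : ℝ} {f u : ℝ → E → E}
    {p q : ℝ → E → ℝ} (h : IsClassicalNSSolutionOn S ν f u p) (hqp : ∀ t ∈ S, q t = p t) :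
    IsClassicalNSSolutionOn S ν f u q where
  smooth_velocity := h.smooth_velocity
  smooth_pressure :=
    h.smooth_pressure.congr fun z hz => by
      change q z.1 z.2 = p z.1 z.2
      rw [hqp z.1 (mem_prod.1 hz).1]
  momentum t ht x := by
    rw [hqp t ht]
    exact h.momentum t ht x
  divFree := h.divFree

end Congr

section TorusShift

variable {d : Type*} [Fintype d] [DecidableEq d]

/-- **Time translation of classical solutions on the torus**: if `(u, p)` solves the system with
force `f` on `S × 𝕋ᵈ`, then `t ↦ (u, p, f)(t + c)` solves it on `((· + c)⁻¹' S) × 𝕋ᵈ` (the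
equations are autonomous; `Torus.IsSmoothSpaceTimeOn.comp_add_const`,
`Torus.timeDerivWithin_comp_add_const`). [folklore] -/
theorem _root_.Literature.Analysis.FunctionSpaces.Torus.IsClassicalNSSolutionOn.comp_add_const
    {S : Set ℝ} {ν : ℝ} {f u : ℝ → UnitAddTorus d → EuclideanSpace ℝ d}
    {p : ℝ → UnitAddTorus d → ℝ} (h : Torus.IsClassicalNSSolutionOn S ν f u p) (c : ℝ) :
    Torus.IsClassicalNSSolutionOn ((· + c) ⁻¹' S) ν (fun t => f (t + c)) (fun t => u (t + c))
      (fun t => p (t + c)) where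
  smooth_velocity := h.smooth_velocity.comp_add_const c
  smooth_pressure := h.smooth_pressure.comp_add_const c
  momentum t ht x := by
    rw [Torus.timeDerivWithin_comp_add_const]
    exact h.momentum (t + c) ht x
  divFree t ht := h.divFree (t + c) ht

end TorusShift

/-! ### Local classical solutions on `𝕋³` from bounded smooth data -/

section TorusLocal

/-- The gradient of the linear form `y ↦ ⟪c, y⟫` is `c`. [folklore] -/
theorem hasGradientAt_inner_const_left {E : Type*} [NormedAddCommGroup E] [InnerProductSpace ℝ E]
    [CompleteSpace E] (c y : E) : HasGradientAt (fun y => ⟪c, y⟫) c y :=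
  (InnerProductSpace.toDual ℝ E c).hasFDerivAt

/-- **Local classical solutions of Navier–Stokes on `𝕋³` from bounded smooth data, with an
existence time controlled by the sup norm.** There are `ε₀ > 0`, `C₀ ≥ 1` and `K ≥ 0` such that:
for every `M > 0`, every initial time `s` and every smooth divergence-free `a : 𝕋³ → ℝ³` with
`‖a(x)‖ ≤ M`, there is a classical solution `(V, Q)` of the unforced Navier–Stokes equations
(`ν = 1`) on `(s, s + ε₀/M²) × 𝕋³` with `‖V(t, x)‖ ≤ C₀M`,
`‖V(t, x) − (e^{(t−s)Δ}ã)(repr x)‖ ≤ K √(t−s) (C₀M)²` (`ã = lift a`; in particular `V(t) → a`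
uniformly as `t ↓ s`) and `∫ V(t) = ∫ a` for all `t` in the window. It is the whole-space bounded
mild solution from the periodic datum `ã` (`exists_classical_of_bounded_data`: KNSS 2009, §4;
Giga–Inui–Matsui 1999), which is periodic, read on the torus; its whole-space pressure `p` has a
periodic gradient, hence `p = θ + ⟨c(t), ·⟩` with `θ` periodic, and the descended system with the
constant force `−c(t)` conserves `∫ V` only if `c ≡ 0`, which the mild formula guarantees
(`Torus.integral_heatExtension_lift_repr`, `Torus.integral_oseenDuhamel_repr_eq_zero`). This is
the classical local well-posedness on the torus (Robinson–Rodrigo–Sadowski 2016, Thm. 6.8 with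
§7.2) in the `L^∞` form needed for continuation arguments driven by the sup norm. [cite: KochNadirashviliSereginSverak2009, §4 p. 8 with §3 p. 6 (arXiv:0709.3599v1)] -/
theorem Torus.exists_classicalNS_of_bounded_data :
    ∃ ε₀ : ℝ, 0 < ε₀ ∧ ∃ C₀ : ℝ, 1 ≤ C₀ ∧ ∃ K : ℝ, 0 ≤ K ∧
      ∀ ⦃M : ℝ⦄, 0 < M → ∀ (s : ℝ) ⦃a : (UnitAddTorus (Fin 3)) → (EuclideanSpace ℝ (Fin 3))⦄,
        Torus.IsSmooth a → Torus.IsDivFree a → (∀ x, ‖a x‖ ≤ M) →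
        ∃ (V : ℝ → (UnitAddTorus (Fin 3)) → (EuclideanSpace ℝ (Fin 3))) (Q : ℝ → (UnitAddTorus (Fin 3)) → ℝ),
          Torus.IsClassicalNSSolutionOn (Ioo s (s + ε₀ / M ^ 2)) 1 0 V Q ∧
          (∀ t ∈ Ioo s (s + ε₀ / M ^ 2), ∀ x, ‖V t x‖ ≤ C₀ * M) ∧
          (∀ t ∈ Ioo s (s + ε₀ / M ^ 2), ∀ x,
            ‖V t x - UnboundedOperators.heatExtension (Torus.lift a) (t - s) (Torus.repr x)‖ ≤
              K * Real.sqrt (t - s) * (C₀ * M) ^ 2) ∧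
          (∀ t ∈ Ioo s (s + ε₀ / M ^ 2), ∫ x, V t x = ∫ x, a x) := by
  have hE : Module.finrank ℝ (EuclideanSpace ℝ (Fin 3)) = 3 := finrank_euclideanSpace_fin
  obtain ⟨ε₀, hε₀, C₀, hC₀, hloc⟩ := exists_classical_of_bounded_data (E := (EuclideanSpace ℝ (Fin 3))) hE
  obtain ⟨CD, hCD, hDuh⟩ := exists_norm_oseenDuhamel_bounded_le (E := (EuclideanSpace ℝ (Fin 3)))
  refine ⟨ε₀, hε₀, C₀, hC₀, 2 * CD, by positivity, fun M hM s a ha hdiv haM => ?_⟩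
  -- the lifted datum
  have halc : ContDiff ℝ ∞ (Torus.lift a) := ha
  have halm : Measurable (Torus.lift a) := halc.continuous.measurable
  have haldiv : IsWeaklyDivFree (Torus.lift a) :=
    VectorCalculus.IsDivFree.isWeaklyDivFree_holds
      ((isDivFree_lift_iff (ha.isContDiff (n := 1) (by exact_mod_cast le_top))).2 hdiv)
      (halc.of_le (by exact_mod_cast le_top))
  have halM : ∀ y, ‖Torus.lift a y‖ ≤ M := fun y => haM _
  obtain ⟨v, p, hcl, hvm, hvout, hveq, hvM, hper⟩ := hloc hM halm haldiv halM
  set h : ℝ := ε₀ / M ^ 2 with hh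
  have hhpos : 0 < h := by positivity
  have hC₀M : 0 ≤ C₀ * M := by nlinarith
  have hSU : UniqueDiffOn ℝ (Ioo (0 : ℝ) h) := isOpen_Ioo.uniqueDiffOn
  -- periodicity of the velocity
  have hperj : ∀ (j : Fin 3) (t : ℝ) (y : (EuclideanSpace ℝ (Fin 3))), v t (y + EuclideanSpace.single j 1) = v t y := by
    intro j t y
    have hc : ∀ z, Torus.lift a (EuclideanSpace.single j (1 : ℝ) + z) = Torus.lift a z := by
      intro z
      rw [Torus.lift_apply, Torus.lift_apply, Torus.proj_add, ← Torus.latticeVec_single,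
        Torus.proj_latticeVec, zero_add]
    rw [add_comm]
    exact hper _ hc t y
  have hperk : ∀ t, Torus.IsLatticePeriodic (v t) := fun t j y => hperj j t y
  -- the torus velocity
  set V : ℝ → (UnitAddTorus (Fin 3)) → (EuclideanSpace ℝ (Fin 3)) := fun t x => v t (Torus.repr x) with hVdef
  have hVlift : ∀ t, Torus.lift (V t) = v t := fun t => Torus.lift_descend_holds (v t) (hperk t)
  -- the pressure gradient is periodic
  have hmomR : ∀ t ∈ Ioo (0 : ℝ) h, ∀ y, gradient (p t) y =
      (1 : ℝ) • (Δ (v t)) y - timeDerivWithin (Ioo 0 h) v t y - convect (v t) (v t) y := by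
    intro t ht y
    have h1 := hcl.momentum t ht y
    simp only [Pi.zero_apply, add_zero] at h1
    rw [sub_sub, h1, sub_sub_cancel]
  have hgradper : ∀ t ∈ Ioo (0 : ℝ) h, ∀ (j : Fin 3) (y : (EuclideanSpace ℝ (Fin 3))),
      gradient (p t) (y + EuclideanSpace.single j 1) = gradient (p t) y := by
    intro t ht j y
    have hfun : ∀ τ, (fun x => v τ (x + EuclideanSpace.single j 1)) = v τ :=
      fun τ => funext (hperj j τ)
    have h1 : (Δ (v t)) (y + EuclideanSpace.single j 1) = (Δ (v t)) y := by
      rw [← Torus.laplacian_comp_add_right (v t) (EuclideanSpace.single j 1) y, hfun t]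
    have h2 : convect (v t) (v t) (y + EuclideanSpace.single j 1) = convect (v t) (v t) y := by
      simp only [convect_apply]
      rw [hperj j t y, ← fderiv_comp_add_right (EuclideanSpace.single j (1 : ℝ)), hfun t]
    have h3 : timeDerivWithin (Ioo 0 h) v t (y + EuclideanSpace.single j 1) =
        timeDerivWithin (Ioo 0 h) v t y := by
      simp only [timeDerivWithin_apply]
      exact derivWithin_congr (fun τ _ => hperj j τ y) (hperj j t y)
    rw [hmomR t ht, hmomR t ht, h1, h2, h3]
  -- hence the periods of the pressure are constant in space
  have hpt_diff : ∀ t ∈ Ioo (0 : ℝ) h, Differentiable ℝ (p t) := fun t ht =>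
    (hcl.smooth_pressure.contDiff_slice ht).differentiable (by simp)
  have hcj : ∀ t ∈ Ioo (0 : ℝ) h, ∀ (j : Fin 3) (y : (EuclideanSpace ℝ (Fin 3))),
      p t (y + EuclideanSpace.single j 1) - p t y = p t (EuclideanSpace.single j 1) - p t 0 := by
    intro t ht j y
    have hd1 : Differentiable ℝ fun x => p t (x + EuclideanSpace.single j 1) :=
      (hpt_diff t ht).comp (differentiable_id.add_const _)
    have hd : Differentiable ℝ fun x => p t (x + EuclideanSpace.single j 1) - p t x :=
      hd1.sub (hpt_diff t ht)
    have hzero : ∀ x, fderiv ℝ (fun x => p t (x + EuclideanSpace.single j 1) - p t x) x = 0 := by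
      intro x
      rw [fderiv_fun_sub (hd1 x) (hpt_diff t ht x), fderiv_comp_add_right, sub_eq_zero]
      have hg := hgradper t ht j x
      simp only [gradient] at hg
      exact (InnerProductSpace.toDual ℝ (EuclideanSpace ℝ (Fin 3))).symm.injective hg
    have := is_const_of_fderiv_eq_zero hd hzero y 0
    simpa using this
  -- the linear part of the pressure and the periodic remainder
  set c : ℝ → Fin 3 → ℝ := fun t j => p t (EuclideanSpace.single j 1) - p t 0 with hcdef
  set cv : ℝ → (EuclideanSpace ℝ (Fin 3)) := fun t => ∑ j, c t j • EuclideanSpace.single j (1 : ℝ) with hcvdef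
  have hcv_inner : ∀ (t : ℝ) (j : Fin 3), ⟪cv t, EuclideanSpace.single j 1⟫ = c t j := by
    intro t j
    have hon := (EuclideanSpace.basisFun (Fin 3) ℝ).orthonormal.inner_left_fintype (c t) j
    simpa [EuclideanSpace.basisFun_apply, hcvdef] using hon
  set θ : ℝ → (EuclideanSpace ℝ (Fin 3)) → ℝ := fun t y => p t y - ⟪cv t, y⟫ with hθdef
  have hθper : ∀ t ∈ Ioo (0 : ℝ) h, Torus.IsLatticePeriodic (θ t) := by
    intro t ht j y
    simp only [hθdef, inner_add_right, hcv_inner]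
    have := hcj t ht j y
    linarith
  have hθgrad : ∀ t ∈ Ioo (0 : ℝ) h, ∀ y, gradient (θ t) y = gradient (p t) y - cv t := by
    intro t ht y
    have hp' : HasFDerivAt (p t) (InnerProductSpace.toDual ℝ (EuclideanSpace ℝ (Fin 3)) (gradient (p t) y)) y :=
      (hpt_diff t ht y).hasGradientAt
    have hi' : HasFDerivAt (fun y : (EuclideanSpace ℝ (Fin 3)) => ⟪cv t, y⟫) (InnerProductSpace.toDual ℝ (EuclideanSpace ℝ (Fin 3)) (cv t)) y :=
      hasGradientAt_inner_const_left (cv t) y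
    have hθ' : HasGradientAt (θ t) (gradient (p t) y - cv t) y := by
      rw [hasGradientAt_iff_hasFDerivAt, map_sub]
      exact hp'.sub hi'
    exact hθ'.gradient
  -- smoothness of the new pressure and of the force
  have hcvs : ContDiffOn ℝ ∞ (fun q : ℝ × (EuclideanSpace ℝ (Fin 3)) => cv q.1) (Ioo 0 h ×ˢ univ) := by
    have hpj : ∀ z : (EuclideanSpace ℝ (Fin 3)), ContDiffOn ℝ ∞ (fun q : ℝ × (EuclideanSpace ℝ (Fin 3)) => p q.1 z) (Ioo 0 h ×ˢ univ) := by
      intro z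
      have hι : ContDiff ℝ ∞ (fun q : ℝ × (EuclideanSpace ℝ (Fin 3)) => ((q.1, z) : ℝ × (EuclideanSpace ℝ (Fin 3)))) :=
        contDiff_fst.prodMk contDiff_const
      exact hcl.smooth_pressure.comp hι.contDiffOn fun q hq => ⟨(mem_prod.1 hq).1, mem_univ _⟩
    simp only [hcvdef, hcdef]
    exact ContDiffOn.sum fun j _ => ((hpj _).sub (hpj _)).smul contDiffOn_const
  have hθs : IsSmoothSpaceTimeOn (Ioo 0 h) θ := by
    have h1 : ContDiffOn ℝ ∞ (fun q : ℝ × (EuclideanSpace ℝ (Fin 3)) => ⟪cv q.1, q.2⟫) (Ioo 0 h ×ˢ univ) :=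
      hcvs.inner ℝ contDiffOn_snd
    exact hcl.smooth_pressure.sub h1
  have hfs : IsSmoothSpaceTimeOn (Ioo 0 h) (fun (t : ℝ) (_ : (EuclideanSpace ℝ (Fin 3))) => -cv t) := by
    show ContDiffOn ℝ ∞ (fun q : ℝ × (EuclideanSpace ℝ (Fin 3)) => -cv q.1) (Ioo 0 h ×ˢ univ)
    exact hcvs.neg
  -- the whole-space system with the constant force `-c(t)` and the periodic pressure `θ`
  have hR3 : IsClassicalNSSolutionOn (Ioo 0 h) 1 (fun (t : ℝ) (_ : (EuclideanSpace ℝ (Fin 3))) => -cv t) v θ :=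
    { smooth_velocity := hcl.smooth_velocity
      smooth_pressure := hθs
      momentum := fun t ht y => by
        have h1 := hcl.momentum t ht y
        simp only [Pi.zero_apply, add_zero] at h1
        rw [h1, hθgrad t ht y]
        abel
      divFree := hcl.divFree }
  -- all data are periodic lifts: descend to the torus
  set Θ : ℝ → (UnitAddTorus (Fin 3)) → ℝ := fun t x => θ t (Torus.repr x) with hΘdef
  set fT : ℝ → (UnitAddTorus (Fin 3)) → (EuclideanSpace ℝ (Fin 3)) := fun t _ => -cv t with hfTdef
  have hΘlift : ∀ t ∈ Ioo (0 : ℝ) h, Torus.lift (Θ t) = θ t := fun t ht =>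
    Torus.lift_descend_holds (θ t) (hθper t ht)
  have hR3' : IsClassicalNSSolutionOn (Ioo 0 h) 1 (fun t => Torus.lift (fT t))
      (fun t => Torus.lift (V t)) (fun t => Torus.lift (Θ t)) := by
    have h1 : IsClassicalNSSolutionOn (Ioo 0 h) 1 (fun t => Torus.lift (fT t)) v θ := hR3
    exact (h1.congr_velocity fun t _ => hVlift t).congr_pressure hΘlift
  have hT : Torus.IsClassicalNSSolutionOn (Ioo 0 h) 1 fT V Θ :=
    IsClassicalNSSolutionOn.to_torus_holds hR3'
  -- the mean of the mild formula does not move, so `c ≡ 0`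
  have hmeanV : ∀ t ∈ Ioo (0 : ℝ) h, ∫ x, V t x = ∫ x, a x := by
    intro t ht
    have hVt : (fun x => V t x) = fun x =>
        UnboundedOperators.heatExtension (Torus.lift a) t (Torus.repr x) -
          oseenDuhamel 1 0 v v t (Torus.repr x) := funext fun x => hveq t ht _
    have hi1 : Integrable (fun x : (UnitAddTorus (Fin 3)) =>
        UnboundedOperators.heatExtension (Torus.lift a) t (Torus.repr x)) volume := by
      have hc : Continuous (UnboundedOperators.heatExtension (Torus.lift a) t) :=
        (TorusHeat.contDiff_heatExtension_lift ha.continuous ht.1 (m := 0)).continuous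
      refine (integrable_const M).mono' (hc.measurable.comp Torus.measurable_repr).aestronglyMeasurable
        (Eventually.of_forall fun x => ?_)
      exact UnboundedOperators.norm_heatExtension_le_of_bound halM ht.1 _
    have hi2 : Integrable (fun x : (UnitAddTorus (Fin 3)) => oseenDuhamel 1 0 v v t (Torus.repr x)) volume := by
      have hi3 : Integrable (fun x : (UnitAddTorus (Fin 3)) => V t x) volume :=
        (hT.smooth_velocity.isSmooth_slice ht).integrable
      have he : (fun x : (UnitAddTorus (Fin 3)) => oseenDuhamel 1 0 v v t (Torus.repr x)) = fun x =>
          UnboundedOperators.heatExtension (Torus.lift a) t (Torus.repr x) - V t x := by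
        funext x
        have := hveq t ht (Torus.repr x)
        simp only [hVdef, this, sub_sub_cancel]
      rw [he]
      exact hi1.sub hi3
    rw [hVt, integral_sub hi1 hi2, Torus.integral_heatExtension_lift_repr ha.continuous ht.1,
      Torus.integral_oseenDuhamel_repr_eq_zero (V := V) one_pos hvm (fun σ _ y => hvM σ y)
        (fun σ hσ => (hT.smooth_velocity.isSmooth_slice ⟨hσ.1, hσ.2.trans ht.2⟩).continuous)
        (fun σ _ => hVlift σ), sub_zero]
  have hc0 : ∀ t ∈ Ioo (0 : ℝ) h, cv t = 0 := by
    intro t ht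
    have hd := hT.hasDerivWithinAt_integral_velocity (convex_Ioo 0 h) ht
    have hconst : HasDerivWithinAt (fun s : ℝ => ∫ x, V s x) 0 (Ioo 0 h) t :=
      (hasDerivWithinAt_const t (Ioo 0 h) (∫ x, a x)).congr (fun s hs => hmeanV s hs) (hmeanV t ht)
    have heq := (hSU t ht).eq_deriv _ hd hconst
    have hint : ∫ x : (UnitAddTorus (Fin 3)), fT t x = -cv t := by
      simp only [hfTdef, integral_const, probReal_univ, one_smul]
    rw [hint] at heq
    exact neg_eq_zero.1 heq
  -- the unforced torus system on `(0, h)`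
  have hT0 : Torus.IsClassicalNSSolutionOn (Ioo 0 h) 1 0 V Θ :=
    { smooth_velocity := hT.smooth_velocity
      smooth_pressure := hT.smooth_pressure
      momentum := fun t ht x => by
        have h1 := hT.momentum t ht x
        simp only [hfTdef, hc0 t ht, neg_zero, add_zero] at h1
        simp only [Pi.zero_apply, add_zero]
        exact h1
      divFree := hT.divFree }
  -- translate to the initial time `s`
  have hTs := hT0.comp_add_const (-s)
  have hf0 : (fun t : ℝ => (0 : ℝ → (UnitAddTorus (Fin 3)) → (EuclideanSpace ℝ (Fin 3))) (t + -s)) = 0 := rfl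
  rw [preimage_add_const_Ioo, sub_neg_eq_add, sub_neg_eq_add, zero_add, add_comm h s, hf0] at hTs
  refine ⟨fun t => V (t + -s), fun t => Θ (t + -s), hTs, fun t ht x => hvM _ _, fun t ht x => ?_,
    fun t ht => ?_⟩
  · -- the Duhamel deviation
    have ht' : t + -s ∈ Ioo (0 : ℝ) h := ⟨by linarith [ht.1], by linarith [ht.2]⟩
    have h1 := hveq (t + -s) ht' (Torus.repr x)
    show ‖v (t + -s) (Torus.repr x) - _‖ ≤ _
    rw [h1, show t - s = t + -s by ring, sub_sub_cancel_left, norm_neg]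
    have h2 := hDuh one_pos (u := v) (v := v) (s := 0) (t := t + -s) (M := C₀ * M) ht'.1 hC₀M
      (fun τ _ y => hvM τ y) (fun τ _ y => hvM τ y) (Torus.repr x)
    rw [Real.one_rpow, mul_one, sub_zero] at h2
    calc ‖oseenDuhamel 1 0 v v (t + -s) (Torus.repr x)‖
        ≤ CD * (C₀ * M) ^ 2 * (2 * Real.sqrt (t + -s)) := h2
      _ = 2 * CD * Real.sqrt (t + -s) * (C₀ * M) ^ 2 := by ring
  · have ht' : t + -s ∈ Ioo (0 : ℝ) h := ⟨by linarith [ht.1], by linarith [ht.2]⟩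
    exact hmeanV _ ht'

end TorusLocal

end Literature.Analysis.FluidPDE

end
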